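import Summits.AnomalousDissipation.AnomalousDissipation.Theses.TaylorCertificates
import Literature.Analysis.FluidPDE.TimeAverageLiouville
import Literature.Analysis.FluidPDE.DoeringFoiasProofs
import Literature.Analysis.FluidPDE.NSStrongSolutions2D
import Literature.Analysis.FluidPDE.StatisticalSolutionEnergyEq
import HarnessLib

/-!
# Route TaylorCertificates — the support `FloorTransfer`

Proof of the route declaration
`Summit.AnomalousDissipation.AnomalousDissipation.Theses.TaylorCertificates.FloorTransfer`
(item stmt-AnomalousDissipation-14087): the **pathwise transfer of a floor certificate**. Let
`ν > 0`, `f` smooth, `θ₁ ≤ 0`, and suppose the FLOOR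
`ε₀ ≤ ν‖∇v‖² + ⟨F(v), Φ₁'(v)⟩ + 2θ₁((v, f) − ν‖∇v‖²)` holds at every finite-enstrophy `v ∈ H` with
`|v|² ≤ ρ`. If `u` is a global Leray–Hopf solution with steady force `f` whose `H`-lift `U`
(`U t = u t` a.e., `t ≥ 0`) stays in that ball, then `ε₀ ≤ meanDissipation ν u`.

## The argument

Write `D(t) = ν‖∇u(t)‖₂²` (spectral), `G(t) = ⟨F(U t), Φ₁'(U t)⟩`, `P(t) = ∫⟪f, u(t)⟫`,
`E₀ = ½‖u₀‖₂²`, and `⟨g⟩_T = T⁻¹∫₀ᵀ g` (`timeMean`).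

1. For a.e. `t ∈ (0, T]` the slice `u(t)` has finite enstrophy (`u ∈ L²(0,T; H¹)`), the spectral
   `‖∇·‖₂²` and the pairing `(·, f)` only see the a.e.-class, so the floor at `v = U t` reads
   `ε₀ ≤ D + G + 2θ₁(P − D)` a.e. on `(0, T]`.
2. `D`, `G`, `P` are integrable on `(0, T]` (`Torus.IsLerayHopfOn.intervalIntegral_dissipation_eq`,
   `Torus.IsGlobalLerayHopf.integrableOn_generator`, weak continuity + the ball for `P`), so
   integrating, `ε₀ T ≤ ∫D + ∫G + 2θ₁(∫P − ∫D)`.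
3. The energy inequality from `0` gives `∫₀ᵀ D ≤ E₀ + ∫₀ᵀ P`
   (`Torus.IsLerayHopfOn.intervalIntegral_dissipation_le`); since `θ₁ ≤ 0`,
   `2θ₁(∫P − ∫D) ≤ −2θ₁E₀`, whence `ε₀ ≤ ⟨D⟩_T + ⟨G⟩_T − 2θ₁E₀/T`.
4. `⟨G⟩_T → 0` by the chain rule `∫₁ᵀ G = Φ₁(U T) − Φ₁(U 1)` and boundedness of `Φ₁`
   (`Torus.IsGlobalLerayHopf.tendsto_timeMean_generator`), `E₀/T → 0`, and `⟨D⟩_T ≤ E₀/T + √ρ‖f‖₂`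
   is bounded, so `ε₀ = lim (ε₀ − ⟨G⟩_T + 2θ₁E₀/T) ≤ limsup ⟨D⟩_T = meanDissipation ν u`
   (`Filter.limsup_le_limsup`).

## References

* C. Foias, O. Manley, R. Rosa, R. Temam, *Navier–Stokes Equations and Turbulence* (CUP 2001),
  Ch. IV §1.2, App. B.2 (B.18)–(B.20). [FoiasManleyRosaTemam2001]
* I. Tobasco, D. Goluskin, C. R. Doering, *Optimal bounds and extremal trajectories for time
  averages in nonlinear dynamical systems*, Phys. Lett. A 382 (2018). [TobascoGoluskinDoering2018]
* S. Chernyshenko, P. Goulart, D. Huang, A. Papachristodoulou, *Polynomial sum of squares in fluid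
  dynamics: a review with a look ahead*, Phil. Trans. R. Soc. A 372 (2014). [ChernyshenkoEtAl2014]
-/

noncomputable section

open MeasureTheory Set Filter Topology UnitAddTorus
open scoped InnerProductSpace RealInnerProductSpace ENNReal NNReal

namespace Summit.AnomalousDissipation.AnomalousDissipation.Theorems

open Literature.Analysis.FluidPDE Literature.Analysis.FunctionSpaces

-- the mandated namespace `Summit.<Summit>.<Problem>.Theorems` repeats `AnomalousDissipation`
-- (single-problem summit)
set_option linter.dupNamespace false

variable {d : Type*} [Fintype d] [DecidableEq d]

variable {ν ε₀ ρ θ₁ : ℝ} {f u₀ : UnitAddTorus d → EuclideanSpace ℝ d}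
  {u : ℝ → UnitAddTorus d → EuclideanSpace ℝ d} {U : ℝ → Torus.energySpace d}

/-! ### The injected power along a lifted trajectory in a ball -/

/-- **The power `P(t) = ∫⟪f, u(t)⟫` along a lifted trajectory in the ball `|U t|² ≤ ρ` is bounded
by `√ρ ‖f‖₂`** for `t ≥ 0` (Cauchy–Schwarz for the pairing `(U t, f)`, which equals `P(t)` since
`U t = u t` a.e.). [folklore] -/
theorem floorTransfer_abs_power_le (hf : MemLp f 2 volume)
    (hU : ∀ t, 0 ≤ t → ((U t).1 : UnitAddTorus d → EuclideanSpace ℝ d) =ᵐ[volume] u t)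
    (hball : ∀ t, 0 ≤ t → ‖U t‖ ^ 2 ≤ ρ) {t : ℝ} (ht : 0 ≤ t) :
    |∫ x, ⟪f x, u t x⟫| ≤ Real.sqrt ρ * ‖hf.toLp f‖ := by
  have hP : ∫ x, ⟪f x, u t x⟫ = Torus.pairing (U t).1 f := by
    rw [Torus.pairing_lift_eq hU f ht]
    exact integral_congr_ae (ae_of_all _ fun x => real_inner_comm (u t x) (f x))
  have hnorm : ‖U t‖ ≤ Real.sqrt ρ := by
    calc ‖U t‖ = Real.sqrt (‖U t‖ ^ 2) := (Real.sqrt_sq (norm_nonneg _)).symm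
      _ ≤ Real.sqrt ρ := Real.sqrt_le_sqrt (hball t ht)
  rw [hP]
  exact (Torus.abs_pairing_coe_le hf (U t)).trans
    (mul_le_mul_of_nonneg_right hnorm (norm_nonneg _))

/-- **The power `t ↦ ∫⟪f, u(t)⟫` is integrable on every `(0, T]`** along a global Leray–Hopf
solution with steady force `f ∈ L²` whose lift stays in a ball: it is continuous on `(0, T]`
(weak `L²` continuity) and bounded by `√ρ ‖f‖₂`. [folklore] -/
theorem floorTransfer_integrableOn_power (hf : MemLp f 2 volume)
    (hu : Torus.IsGlobalLerayHopf ν (fun _ => f) u₀ u)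
    (hU : ∀ t, 0 ≤ t → ((U t).1 : UnitAddTorus d → EuclideanSpace ℝ d) =ᵐ[volume] u t)
    (hball : ∀ t, 0 ≤ t → ‖U t‖ ^ 2 ≤ ρ) {T : ℝ} (hT : 0 < T) :
    IntegrableOn (fun t => ∫ x, ⟪f x, u t x⟫) (Ioc 0 T) := by
  have hcont : ContinuousOn (fun t => ∫ x, ⟪f x, u t x⟫) (Ioc 0 T) := by
    refine ((hu T hT).weak_continuous f hf).1.congr fun t _ => ?_
    simp only [real_inner_comm (f _)]
  refine IntegrableOn.of_bound measure_Ioc_lt_top (hcont.aestronglyMeasurable measurableSet_Ioc)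
    (Real.sqrt ρ * ‖hf.toLp f‖) ?_
  filter_upwards [ae_restrict_mem measurableSet_Ioc] with t ht
  rw [Real.norm_eq_abs]
  exact floorTransfer_abs_power_le hf hU hball ht.1.le

/-! ### The floor along the trajectory -/

/-- **The floor holds along the trajectory for a.e. time.** If the FLOOR
`ε₀ ≤ ν‖∇v‖² + ⟨F(v), Φ₁'(v)⟩ + 2θ₁((v, f) − ν‖∇v‖²)` holds at every finite-enstrophy `v ∈ H`
with `|v|² ≤ ρ`, then along a global Leray–Hopf solution whose lift `U` stays in that ball,
for a.e. `t ∈ (0, T]`: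
`ε₀ ≤ ν‖∇u(t)‖₂² + ⟨F(U t), Φ₁'(U t)⟩ + 2θ₁(∫⟪f, u(t)⟫ − ν‖∇u(t)‖₂²)` — the slices have finite
enstrophy for a.e. `t` (`u ∈ L²(0,T; H¹)`), and `‖∇·‖₂²`, `(·, f)` only see the a.e.-class
`U t = u t`. [folklore] -/
theorem floorTransfer_ae_floor {Φ₁ : Torus.CylindricalTest d}
    (hfloor : ∀ v : Torus.energySpace d,
      Torus.eGradNormSq (v.1 : UnitAddTorus d → EuclideanSpace ℝ d) ≠ ⊤ → ‖v‖ ^ 2 ≤ ρ →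
        ε₀ ≤ ν * (Torus.eGradNormSq (v.1 : UnitAddTorus d → EuclideanSpace ℝ d)).toReal +
          Torus.nsGeneratorPairing ν f v (Φ₁.grad v) +
            2 * θ₁ * (Torus.pairing v.1 f -
              ν * (Torus.eGradNormSq (v.1 : UnitAddTorus d → EuclideanSpace ℝ d)).toReal))
    (hu : Torus.IsGlobalLerayHopf ν (fun _ => f) u₀ u)
    (hU : ∀ t, 0 ≤ t → ((U t).1 : UnitAddTorus d → EuclideanSpace ℝ d) =ᵐ[volume] u t)
    (hball : ∀ t, 0 ≤ t → ‖U t‖ ^ 2 ≤ ρ) {T : ℝ} (hT : 0 < T) :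
    ∀ᵐ t ∂(volume.restrict (Ioc 0 T)),
      ε₀ ≤ ν * (Torus.eGradNormSq (u t)).toReal +
        Torus.nsGeneratorPairing ν f (U t) (Φ₁.grad (U t)) +
          2 * θ₁ * ((∫ x, ⟪f x, u t x⟫) - ν * (Torus.eGradNormSq (u t)).toReal) := by
  have hLH := hu T hT
  have hae : ∀ᵐ t ∂(volume.restrict (Ioo 0 T)), Torus.eGradNormSq (u t) < ∞ :=
    ae_lt_top' hLH.aemeasurable_eGradNormSq hLH.lintegral_eGradNormSq_lt_top.ne
  rw [← Measure.restrict_congr_set (Ioo_ae_eq_Ioc (μ := (volume : Measure ℝ)) (a := 0) (b := T))]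
  filter_upwards [hae, ae_restrict_mem measurableSet_Ioo] with t ht htmem
  have ht0 : 0 ≤ t := htmem.1.le
  have hcongr :
      Torus.eGradNormSq ((U t).1 : UnitAddTorus d → EuclideanSpace ℝ d) = Torus.eGradNormSq (u t) :=
    eGradNormSq_congr_ae (hU t ht0)
  have hfin : Torus.eGradNormSq ((U t).1 : UnitAddTorus d → EuclideanSpace ℝ d) ≠ ⊤ := by
    rw [hcongr]
    exact ht.ne
  have hP : Torus.pairing (U t).1 f = ∫ x, ⟪f x, u t x⟫ := by
    rw [Torus.pairing_lift_eq hU f ht0]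
    exact integral_congr_ae (ae_of_all _ fun x => real_inner_comm (f x) (u t x))
  have h := hfloor (U t) hfin (hball t ht0)
  rw [hcongr, hP] at h
  exact h

/-! ### The transfer -/

/-- **Pathwise transfer of a floor certificate (general dimension).** For a viscosity `ν` (no sign
condition is needed), a smooth force `f`, a weight `θ₁ ≤ 0` and a FLOOR
`ε₀ ≤ ν‖∇v‖² + ⟨F(v), Φ₁'(v)⟩ + 2θ₁((v, f) − ν‖∇v‖²)` valid at every finite-enstrophy `v ∈ H` with
`|v|² ≤ ρ`: every global Leray–Hopf solution `u` with steady
force `f` whose `H`-lift stays in the ball has `ε₀ ≤ meanDissipation ν u`. Integrate the floor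
along the trajectory on `(0, T]`; the generator term is a time derivative with vanishing Cesàro
means (chain rule for cylindrical functionals, FMRT 2001 App. B.2), the energy channel is paid by
the initial energy (energy inequality from `0` and the sign of `θ₁`), and the running means of the
dissipation are bounded (by `½‖u₀‖²/T + √ρ‖f‖₂`), so the `lim sup` is honest.
[cite: FoiasManleyRosaTemam2001, Ch. IV §1.2 & App. B.2 (B.18)–(B.20)] -/
theorem floorTransfer_of_lift {Φ₁ : Torus.CylindricalTest d} (hf : Torus.IsSmooth f) (hθ : θ₁ ≤ 0)
    (hfloor : ∀ v : Torus.energySpace d,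
      Torus.eGradNormSq (v.1 : UnitAddTorus d → EuclideanSpace ℝ d) ≠ ⊤ → ‖v‖ ^ 2 ≤ ρ →
        ε₀ ≤ ν * (Torus.eGradNormSq (v.1 : UnitAddTorus d → EuclideanSpace ℝ d)).toReal +
          Torus.nsGeneratorPairing ν f v (Φ₁.grad v) +
            2 * θ₁ * (Torus.pairing v.1 f -
              ν * (Torus.eGradNormSq (v.1 : UnitAddTorus d → EuclideanSpace ℝ d)).toReal))
    (hu : Torus.IsGlobalLerayHopf ν (fun _ => f) u₀ u)
    (hU : ∀ t, 0 ≤ t → ((U t).1 : UnitAddTorus d → EuclideanSpace ℝ d) =ᵐ[volume] u t)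
    (hball : ∀ t, 0 ≤ t → ‖U t‖ ^ 2 ≤ ρ) :
    ε₀ ≤ meanDissipation ν u := by
  have hfL2 : MemLp f 2 volume := hf.memLp 2
  set D : ℝ → ℝ := fun t => ν * (Torus.eGradNormSq (u t)).toReal with hD
  set G : ℝ → ℝ := fun t => Torus.nsGeneratorPairing ν f (U t) (Φ₁.grad (U t)) with hG
  set P : ℝ → ℝ := fun t => ∫ x, ⟪f x, u t x⟫ with hP
  set E₀ : ℝ := Torus.kineticEnergy u₀ with hE₀
  set B : ℝ := Real.sqrt ρ * ‖hfL2.toLp f‖ with hB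
  have hE0 : 0 ≤ E₀ := Torus.kineticEnergy_nonneg _
  -- the running-mean inequalities, for every `T > 0`
  have key : ∀ T, 0 < T →
      ε₀ ≤ timeMean D T + timeMean G T + (-(2 * θ₁ * E₀)) * T⁻¹ ∧
        timeMean D T ≤ E₀ * T⁻¹ + B := by
    intro T hT
    have hLH := hu T hT
    -- integrability on `(0, T]`
    have hDI : IntegrableOn D (Ioc 0 T) :=
      (intervalIntegrable_iff_integrableOn_Ioc_of_le hT.le).1
        (hLH.intervalIntegral_dissipation_eq hT).1
    have hGI : IntegrableOn G (Ioc 0 T) := hu.integrableOn_generator hfL2 hU Φ₁ hT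
    have hPI : IntegrableOn P (Ioc 0 T) := floorTransfer_integrableOn_power hfL2 hu hU hball hT
    -- integrate the a.e. floor over `(0, T]`
    have hfl := floorTransfer_ae_floor hfloor hu hU hball hT
    have hRI : Integrable (fun t => D t + G t + 2 * θ₁ * (P t - D t)) (volume.restrict (Ioc 0 T)) :=
      (hDI.add hGI).add ((hPI.sub hDI).const_mul _)
    have hI : ∫ _ in Ioc 0 T, ε₀ ≤ ∫ t in Ioc 0 T, (D t + G t + 2 * θ₁ * (P t - D t)) :=
      integral_mono_ae (integrable_const _) hRI hfl
    have hlhs : ∫ _ in Ioc 0 T, ε₀ = ε₀ * T := by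
      rw [setIntegral_const, Real.volume_real_Ioc_of_le hT.le, sub_zero, smul_eq_mul, mul_comm]
    have hrhs : ∫ t in Ioc 0 T, (D t + G t + 2 * θ₁ * (P t - D t)) =
        (∫ t in Ioc 0 T, D t) + (∫ t in Ioc 0 T, G t) +
          2 * θ₁ * ((∫ t in Ioc 0 T, P t) - ∫ t in Ioc 0 T, D t) := by
      have h1 : Integrable (fun t => D t + G t) (volume.restrict (Ioc 0 T)) := hDI.add hGI
      have h2 : Integrable (fun t => 2 * θ₁ * (P t - D t)) (volume.restrict (Ioc 0 T)) :=
        (hPI.sub hDI).const_mul _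
      rw [integral_add h1 h2, integral_add hDI hGI,
        integral_const_mul (2 * θ₁) (fun t => P t - D t), integral_sub hPI hDI]
    rw [hlhs, hrhs] at hI
    -- the energy inequality from `0`: `∫D ≤ E₀ + ∫P`
    have hEn := hLH.intervalIntegral_dissipation_le hT
    rw [intervalIntegral.integral_of_le hT.le, intervalIntegral.integral_of_le hT.le, ← hE₀] at hEn
    -- `|∫P| ≤ B T`
    have hPb : |∫ t in Ioc 0 T, P t| ≤ B * T := by
      have h := norm_setIntegral_le_of_norm_le_const (μ := (volume : Measure ℝ)) (s := Ioc 0 T)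
        (f := P) (C := B) measure_Ioc_lt_top fun t ht => by
          rw [Real.norm_eq_abs]
          exact floorTransfer_abs_power_le hfL2 hU hball ht.1.le
      rwa [Real.norm_eq_abs, Real.volume_real_Ioc_of_le hT.le, sub_zero] at h
    have hPle := (abs_le.1 hPb).2
    -- the sign of `θ₁`
    have hθ' : 0 ≤ -(2 * θ₁) := by linarith
    have hchan : 2 * θ₁ * ((∫ t in Ioc 0 T, P t) - ∫ t in Ioc 0 T, D t) ≤ -(2 * θ₁ * E₀) := by
      have h1 : -E₀ ≤ (∫ t in Ioc 0 T, P t) - ∫ t in Ioc 0 T, D t := by linarith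
      nlinarith
    have hTi : 0 < T⁻¹ := inv_pos.2 hT
    have hTT : T⁻¹ * T = 1 := inv_mul_cancel₀ hT.ne'
    simp only [timeMean, intervalIntegral.integral_of_le hT.le]
    constructor
    · -- `ε₀ T ≤ ∫D + ∫G − 2θ₁E₀`
      have h2 : ε₀ * T ≤ (∫ t in Ioc 0 T, D t) + (∫ t in Ioc 0 T, G t) + -(2 * θ₁ * E₀) := by
        linarith
      have h3 := mul_le_mul_of_nonneg_left h2 hTi.le
      calc ε₀ = T⁻¹ * (ε₀ * T) := by rw [mul_comm ε₀ T, ← mul_assoc, hTT, one_mul]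
        _ ≤ T⁻¹ * ((∫ t in Ioc 0 T, D t) + (∫ t in Ioc 0 T, G t) + -(2 * θ₁ * E₀)) := h3
        _ = T⁻¹ * (∫ t in Ioc 0 T, D t) + T⁻¹ * (∫ t in Ioc 0 T, G t) +
              -(2 * θ₁ * E₀) * T⁻¹ := by ring
    · -- `⟨D⟩_T ≤ E₀/T + B`
      calc T⁻¹ * ∫ t in Ioc 0 T, D t ≤ T⁻¹ * (E₀ + B * T) :=
            mul_le_mul_of_nonneg_left (by linarith) hTi.le
        _ = E₀ * T⁻¹ + B * (T⁻¹ * T) := by ring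
        _ = E₀ * T⁻¹ + B := by rw [hTT, mul_one]
  -- pass to the `lim sup`
  have hT1 : ∀ᶠ T : ℝ in atTop, 1 ≤ T := eventually_ge_atTop 1
  have hGlim : Tendsto (timeMean G) atTop (𝓝 0) := hu.tendsto_timeMean_generator hfL2 hU Φ₁
  have hKlim : Tendsto (fun T : ℝ => (-(2 * θ₁ * E₀)) * T⁻¹) atTop (𝓝 0) := by
    simpa using tendsto_inv_atTop_zero.const_mul (-(2 * θ₁ * E₀))
  have hlow : Tendsto (fun T : ℝ => ε₀ - (timeMean G T + (-(2 * θ₁ * E₀)) * T⁻¹)) atTop (𝓝 ε₀) := by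
    have h := (hGlim.add hKlim).const_sub ε₀
    simpa using h
  have hle : ∀ᶠ T in atTop, ε₀ - (timeMean G T + (-(2 * θ₁ * E₀)) * T⁻¹) ≤ timeMean D T := by
    filter_upwards [hT1] with T hT
    linarith [(key T (by linarith)).1]
  have hDle : ∀ᶠ T in atTop, timeMean D T ≤ E₀ + B := by
    filter_upwards [hT1] with T hT
    have hinv : E₀ * T⁻¹ ≤ E₀ :=
      (mul_le_mul_of_nonneg_left (inv_le_one_of_one_le₀ hT) hE0).trans_eq (mul_one _)
    linarith [(key T (by linarith)).2]
  calc ε₀ = limsup (fun T : ℝ => ε₀ - (timeMean G T + (-(2 * θ₁ * E₀)) * T⁻¹)) atTop :=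
        hlow.limsup_eq.symm
    _ ≤ limsup (timeMean D) atTop :=
        limsup_le_limsup hle hlow.isBoundedUnder_ge.isCoboundedUnder_le
          (isBoundedUnder_of_eventually_le hDle)
    _ = meanDissipation ν u := rfl

/-- **`FloorTransfer` (item stmt-AnomalousDissipation-14087)** — pathwise transfer of a FLOOR
certificate on `T³`: for `ν > 0`, `f` smooth, `θ₁ ≤ 0`, a floor
`ε₀ ≤ ν‖∇v‖² + ⟨F(v), Φ₁'(v)⟩ + 2θ₁((v, f) − ν‖∇v‖²)` valid on `{v ∈ H : |v|² ≤ ρ, ‖∇v‖ < ∞}`, and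
a global Leray–Hopf `u` (datum `u₀`) with `H`-lift `U` staying in that ball,
`ε₀ ≤ meanDissipation ν u` (`floorTransfer_of_lift` at `d = Fin 3`).
[cite: FoiasManleyRosaTemam2001, Ch. IV §1.2 & App. B.2 (B.18)–(B.20)] -/
theorem floorTransfer_proof :
    Summit.AnomalousDissipation.AnomalousDissipation.Theses.TaylorCertificates.FloorTransfer := by
  intro ν ε₀ ρ θ₁ f u₀ u U Φ₁ _hν hf hθ hfloor hu hU hball
  exact floorTransfer_of_lift hf hθ hfloor hu hU hball

end Summit.AnomalousDissipation.AnomalousDissipation.Theorems
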